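import Summits.AtomisticToContinuum.FouriersLaw.Theorems.OddSectorIrreversibilityTapLeakBoundSplitGlue
import Summits.AtomisticToContinuum.FouriersLaw.Theorems.OddSectorIrreversibilitySubBallisticWindowGibbsMoments
import Summits.AtomisticToContinuum.FouriersLaw.Theorems.OddSectorIrreversibilitySubBallisticWindowGibbsPoincare
import Summits.AtomisticToContinuum.FouriersLaw.Theorems.PhononMeanFreePathCoherentDephasingHeadBound
import Summits.AtomisticToContinuum.FouriersLaw.Theorems.LatticeLandauDampingLoweredCurrent

/-!
# `TapLeakBound` (stmt-AtomisticToContinuum-15159), line `SketchIdeator2`, stub `stub_localMoment`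

Helper file (`--supports stmt-AtomisticToContinuum-15159`; proves the registered stub `stub_localMoment`)
for crux P = `Summit.AtomisticToContinuum.FouriersLaw.Theses.OddSectorIrreversibility.TapLeakBound`
(route `OddSectorIrreversibility`, sub-problem `FouriersLaw`).

**The `N`-uniform bound on the local source term `‖∂_{p_b} J‖²_{L²(μ_T)} ≤ C · Z`.** Here
`μ_T = e^{-H/T} dq dp` is the unnormalised Gibbs weight (`gibbsWeight ω₂ lam β γ N T`) of the pinned chain
(`ω₂ > 0`, `lam, β ≥ 0`, `T > 0`), `Z = ∫ e^{-H/T}`, and `J = Σ_k j_k` is the total current,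
`j_k = -½ (p_k + p_{k+1}) V'(q_{k+1} - q_k)`, `V'(r) = r + β r³` (`pinnedChain_deriv_V`).

Proof. The momentum derivative of the total current is a function of the positions only:
`∂_{p_b} J = -½ (V'(q_{b+1} - q_b)·[b+1 < N] + V'(q_b - q_{b-1})·[0 < b])`
(`LoweredCurrent.partialP_sum_bondCurrent`, with `rightTerm` / `leftTerm`). Pointwise,
`(∂_{p_b} J)² ≤ ½ (R² + L²)` and `V'(a - c)² = ((a-c) + β(a-c)³)² ≤ 4(a² + c²) + 64 β² (a⁶ + c⁶)`
(the tree's `CoherentDephasing.HeadBound.bondForce_sq_le`, reused), so `(∂_{p_b} J)²` is dominated by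
`½ (w(q_{j₁}, q_b) + w(q_b, q_{j₂}))`, `w(a, c) = 4(a² + c²) + 64β²(a⁶ + c⁶)`, for two sites `j₁, j₂`
(the neighbours of `b` when they exist, else `b` itself — the corresponding term then vanishes). The landed
`N`-UNIFORM single-coordinate Gibbs moments `∫ q_i² dμ_T ≤ C₁ Z`, `∫ q_i⁶ dμ_T ≤ C₃ Z`
(`SubBallisticWindow.GibbsMoments.stub_gibbsMoments`, whose Poincaré hypothesis is
`SubBallisticWindow.GibbsPoincare.stub_gibbsPoincare`) give `∫ w(q_i, q_j) dμ_T ≤ (8 C₁ + 128 β² C₃) Z` for all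
sites `i, j`, whence `∫ (∂_{p_b} J)² dμ_T ≤ (8 C₁ + 128 β² C₃) Z =: C Z`, `C` independent of `N` and `b`;
`∂_{p_b} J ∈ L²(μ_T)` because it is continuous (`continuous_partialP`, `contDiff_totalBondCurrent`) with an
integrable square. The bound holds at every site `b` (the contact hypothesis `b ∈ {0, N-1}` is not used) and for
`N = 1` (both bond terms vanish). References: folklore. Nothing here closes the item.
-/

noncomputable section

open MeasureTheory ProbabilityTheory Filter Topology Set Function
open scoped NNReal ENNReal ContDiff

namespace Summit.AtomisticToContinuum.FouriersLaw.Theorems.OddSectorIrreversibility.TapLeak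

open Literature.MathematicalPhysics.KineticTheory.HeatConduction
open Literature.MathematicalPhysics.KineticTheory
open Literature.Barriers.AtomisticToContinuum (rightTerm leftTerm)
open Summit.AtomisticToContinuum.FouriersLaw.Theorems.OddSectorWitness
open Summit.AtomisticToContinuum.FouriersLaw.Theorems.OddSectorIrreversibility.Corrector
open Summit.AtomisticToContinuum.FouriersLaw.Theorems.SubBallisticWindow

/-! ### The two bond terms of `∂_{p_b} J`, dominated by single-site monomials -/

variable {N : ℕ}

/-- At every site `b` there is a site `j` (the right neighbour `b + 1` if it exists, else `b` itself) with
`(V'(q_{b+1} - q_b)·[b+1 < N])² ≤ 4 (q_j² + q_b²) + 64 β² (q_j⁶ + q_b⁶)` (`bondForce_sq_le`; the term is `0`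
without a right neighbour). [folklore] -/
theorem localMoment_exists_rightTerm_sq_le (β : ℝ) (b : Fin N) :
    ∃ j : Fin N, ∀ q : Fin N → ℝ,
      (rightTerm (fun r => r + β * r ^ 3) q b) ^ 2 ≤
        4 * ((q j) ^ 2 + (q b) ^ 2) + 64 * β ^ 2 * ((q j) ^ 6 + (q b) ^ 6) := by
  by_cases h : b.val + 1 < N
  · refine ⟨⟨b.val + 1, h⟩, fun q => ?_⟩
    simp only [rightTerm, dif_pos h]
    exact CoherentDephasing.HeadBound.bondForce_sq_le β (q ⟨b.val + 1, h⟩) (q b)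
  · refine ⟨b, fun q => ?_⟩
    simp only [rightTerm, dif_neg h]
    have h0 : (0 : ℝ) ^ 2 = 0 := by norm_num
    rw [h0]
    positivity

/-- At every site `b` there is a site `j` (the left neighbour `b - 1` if it exists, else `b` itself) with
`(V'(q_b - q_{b-1})·[0 < b])² ≤ 4 (q_b² + q_j²) + 64 β² (q_b⁶ + q_j⁶)` (`bondForce_sq_le`; the term is `0`
without a left neighbour). [folklore] -/
theorem localMoment_exists_leftTerm_sq_le (β : ℝ) (b : Fin N) :
    ∃ j : Fin N, ∀ q : Fin N → ℝ,
      (leftTerm (fun r => r + β * r ^ 3) q b) ^ 2 ≤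
        4 * ((q b) ^ 2 + (q j) ^ 2) + 64 * β ^ 2 * ((q b) ^ 6 + (q j) ^ 6) := by
  by_cases h : 0 < b.val
  · refine ⟨⟨b.val - 1, by omega⟩, fun q => ?_⟩
    simp only [leftTerm, dif_pos h]
    exact CoherentDephasing.HeadBound.bondForce_sq_le β (q b) (q ⟨b.val - 1, by omega⟩)
  · refine ⟨b, fun q => ?_⟩
    simp only [leftTerm, dif_neg h]
    have h0 : (0 : ℝ) ^ 2 = 0 := by norm_num
    rw [h0]
    positivity

/-! ### The Gibbs integral of the majorant and the core estimate at fixed `N` -/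

section Core

variable {ω₂ lam β : ℝ} (hω : 0 < ω₂) (hl : 0 ≤ lam) (hβ : 0 ≤ β) (γ : ℝ) {T : ℝ} (hT : 0 < T)
include hω hl hβ hT

/-- Every monomial `q_i^k` is integrable against the Gibbs weight. [folklore] -/
theorem localMoment_integrable_position_pow (i : Fin N) (k : ℕ) :
    Integrable (fun x : PhaseSpace N => (x.1 i) ^ k) (gibbsWeight ω₂ lam β γ N T) :=
  GibbsMoments.integrable_pow_gibbs γ N hω hl hβ hT rfl ((continuous_apply i).comp continuous_fst)
    (GibbsMoments.abs_position_le hω hl hβ γ N · i) k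

/-- The majorant `w(q_i, q_j) = 4 (q_i² + q_j²) + 64 β² (q_i⁶ + q_j⁶)` is `μ_T`-integrable with
`∫ w(q_i, q_j) dμ_T ≤ (8 C₁ + 128 β² C₃) Z` whenever `∫ q_k² dμ_T ≤ C₁ Z` and `∫ q_k⁶ dμ_T ≤ C₃ Z` for all
sites `k`. [folklore] -/
theorem localMoment_integral_majorant_le {C₁ C₃ : ℝ}
    (hq2 : ∀ k : Fin N, ∫ x, (x.1 k) ^ 2 ∂(gibbsWeight ω₂ lam β γ N T) ≤
      C₁ * ∫ x, Real.exp (-((pinnedChain ω₂ lam β γ).hamiltonian N x) / T) ∂volume)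
    (hq6 : ∀ k : Fin N, ∫ x, (x.1 k) ^ 6 ∂(gibbsWeight ω₂ lam β γ N T) ≤
      C₃ * ∫ x, Real.exp (-((pinnedChain ω₂ lam β γ).hamiltonian N x) / T) ∂volume)
    (i j : Fin N) :
    Integrable (fun x : PhaseSpace N => 4 * ((x.1 i) ^ 2 + (x.1 j) ^ 2) + 64 * β ^ 2 * ((x.1 i) ^ 6 + (x.1 j) ^ 6))
        (gibbsWeight ω₂ lam β γ N T) ∧
      ∫ x, (4 * ((x.1 i) ^ 2 + (x.1 j) ^ 2) + 64 * β ^ 2 * ((x.1 i) ^ 6 + (x.1 j) ^ 6))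
          ∂(gibbsWeight ω₂ lam β γ N T) ≤
        (8 * C₁ + 128 * β ^ 2 * C₃) * ∫ x, Real.exp (-((pinnedChain ω₂ lam β γ).hamiltonian N x) / T) ∂volume := by
  have hint := localMoment_integrable_position_pow (N := N) hω hl hβ γ hT
  have hA : Integrable (fun x : PhaseSpace N => 4 * ((x.1 i) ^ 2 + (x.1 j) ^ 2)) (gibbsWeight ω₂ lam β γ N T) :=
    ((hint i 2).add (hint j 2)).const_mul 4
  have hB : Integrable (fun x : PhaseSpace N => 64 * β ^ 2 * ((x.1 i) ^ 6 + (x.1 j) ^ 6))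
      (gibbsWeight ω₂ lam β γ N T) :=
    ((hint i 6).add (hint j 6)).const_mul _
  refine ⟨hA.add hB, ?_⟩
  rw [integral_add hA hB, integral_const_mul, integral_const_mul, integral_add (hint i 2) (hint j 2),
    integral_add (hint i 6) (hint j 6)]
  have h6 : 64 * β ^ 2 * (∫ x, (x.1 i) ^ 6 ∂(gibbsWeight ω₂ lam β γ N T) +
      ∫ x, (x.1 j) ^ 6 ∂(gibbsWeight ω₂ lam β γ N T)) ≤
      64 * β ^ 2 * (C₃ * (∫ x, Real.exp (-((pinnedChain ω₂ lam β γ).hamiltonian N x) / T) ∂volume) +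
        C₃ * ∫ x, Real.exp (-((pinnedChain ω₂ lam β γ).hamiltonian N x) / T) ∂volume) :=
    mul_le_mul_of_nonneg_left (add_le_add (hq6 i) (hq6 j)) (by positivity)
  have h2i := hq2 i
  have h2j := hq2 j
  linarith

/-- **The core estimate at fixed `N`.** Given the second and sixth single-site Gibbs moments with constants
`C₁, C₃`: `∂_{p_b} J ∈ L²(μ_T)` and `∫ (∂_{p_b} J)² dμ_T ≤ (8 C₁ + 128 β² C₃) Z`, at every site `b`.
[folklore] -/
theorem localMoment_core {C₁ C₃ : ℝ}
    (hq2 : ∀ k : Fin N, ∫ x, (x.1 k) ^ 2 ∂(gibbsWeight ω₂ lam β γ N T) ≤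
      C₁ * ∫ x, Real.exp (-((pinnedChain ω₂ lam β γ).hamiltonian N x) / T) ∂volume)
    (hq6 : ∀ k : Fin N, ∫ x, (x.1 k) ^ 6 ∂(gibbsWeight ω₂ lam β γ N T) ≤
      C₃ * ∫ x, Real.exp (-((pinnedChain ω₂ lam β γ).hamiltonian N x) / T) ∂volume)
    (b : Fin N) :
    MemLp (partialP b (fun z : PhaseSpace N => ∑ k : Fin N, (pinnedChain ω₂ lam β γ).bondCurrent N k z)) 2
        (gibbsWeight ω₂ lam β γ N T) ∧
      ∫ x, (partialP b (fun z : PhaseSpace N => ∑ k : Fin N, (pinnedChain ω₂ lam β γ).bondCurrent N k z) x) ^ 2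
          ∂(gibbsWeight ω₂ lam β γ N T) ≤
        (8 * C₁ + 128 * β ^ 2 * C₃) * ∫ x, Real.exp (-((pinnedChain ω₂ lam β γ).hamiltonian N x) / T) ∂volume := by
  set P := pinnedChain ω₂ lam β γ with hP
  set μ := gibbsWeight ω₂ lam β γ N T with hμ
  set J : PhaseSpace N → ℝ := fun z => ∑ k : Fin N, P.bondCurrent N k z with hJ
  -- the derivative formula `∂_{p_b} J = -½ (R + L)` with `V' = r + β r³`
  have hV : deriv P.V = fun r => r + β * r ^ 3 := funext fun r => pinnedChain_deriv_V ω₂ lam β γ r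
  have hd : ∀ x, partialP b J x = -(1 / 2) * (rightTerm (fun r => r + β * r ^ 3) x.1 b +
      leftTerm (fun r => r + β * r ^ 3) x.1 b) := fun x => by
    rw [hJ, LoweredCurrent.partialP_sum_bondCurrent P b x, hV]
  obtain ⟨j₁, hj₁⟩ := localMoment_exists_rightTerm_sq_le (N := N) β b
  obtain ⟨j₂, hj₂⟩ := localMoment_exists_leftTerm_sq_le (N := N) β b
  obtain ⟨hI₁, hle₁⟩ := localMoment_integral_majorant_le hω hl hβ γ hT hq2 hq6 j₁ b
  obtain ⟨hI₂, hle₂⟩ := localMoment_integral_majorant_le hω hl hβ γ hT hq2 hq6 b j₂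
  -- pointwise domination by `½ (w(q_{j₁}, q_b) + w(q_b, q_{j₂}))`
  have hptw : ∀ x : PhaseSpace N, (partialP b J x) ^ 2 ≤
      (1 / 2) * ((4 * ((x.1 j₁) ^ 2 + (x.1 b) ^ 2) + 64 * β ^ 2 * ((x.1 j₁) ^ 6 + (x.1 b) ^ 6)) +
        (4 * ((x.1 b) ^ 2 + (x.1 j₂) ^ 2) + 64 * β ^ 2 * ((x.1 b) ^ 6 + (x.1 j₂) ^ 6))) := fun x => by
    rw [hd x]
    have hR := hj₁ x.1
    have hL := hj₂ x.1
    nlinarith [sq_nonneg (rightTerm (fun r => r + β * r ^ 3) x.1 b - leftTerm (fun r => r + β * r ^ 3) x.1 b)]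
  have hGint : Integrable (fun x : PhaseSpace N =>
      (1 / 2) * ((4 * ((x.1 j₁) ^ 2 + (x.1 b) ^ 2) + 64 * β ^ 2 * ((x.1 j₁) ^ 6 + (x.1 b) ^ 6)) +
        (4 * ((x.1 b) ^ 2 + (x.1 j₂) ^ 2) + 64 * β ^ 2 * ((x.1 b) ^ 6 + (x.1 j₂) ^ 6)))) μ :=
    (hI₁.add hI₂).const_mul _
  have hJc : Continuous (partialP b J) := continuous_partialP (contDiff_totalBondCurrent ω₂ lam β γ N) (by simp) b
  have hJm : AEStronglyMeasurable (partialP b J) μ := hJc.aestronglyMeasurable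
  have hsqI : Integrable (fun x => (partialP b J x) ^ 2) μ :=
    hGint.mono' (hJm.pow 2) (Eventually.of_forall fun x => by
      rw [Real.norm_eq_abs, abs_of_nonneg (sq_nonneg _)]
      exact hptw x)
  refine ⟨(memLp_two_iff_integrable_sq hJm).2 hsqI, ?_⟩
  calc ∫ x, (partialP b J x) ^ 2 ∂μ
      ≤ ∫ x, (1 / 2) * ((4 * ((x.1 j₁) ^ 2 + (x.1 b) ^ 2) + 64 * β ^ 2 * ((x.1 j₁) ^ 6 + (x.1 b) ^ 6)) +
          (4 * ((x.1 b) ^ 2 + (x.1 j₂) ^ 2) + 64 * β ^ 2 * ((x.1 b) ^ 6 + (x.1 j₂) ^ 6))) ∂μ :=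
        integral_mono hsqI hGint hptw
    _ = (1 / 2) * ((∫ x, (4 * ((x.1 j₁) ^ 2 + (x.1 b) ^ 2) + 64 * β ^ 2 * ((x.1 j₁) ^ 6 + (x.1 b) ^ 6)) ∂μ) +
          ∫ x, (4 * ((x.1 b) ^ 2 + (x.1 j₂) ^ 2) + 64 * β ^ 2 * ((x.1 b) ^ 6 + (x.1 j₂) ^ 6)) ∂μ) := by
        rw [integral_const_mul, integral_add hI₁ hI₂]
    _ ≤ (1 / 2) * ((8 * C₁ + 128 * β ^ 2 * C₃) * (∫ x, Real.exp (-(P.hamiltonian N x) / T) ∂volume) +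
          (8 * C₁ + 128 * β ^ 2 * C₃) * ∫ x, Real.exp (-(P.hamiltonian N x) / T) ∂volume) := by
        gcongr
    _ = (8 * C₁ + 128 * β ^ 2 * C₃) * ∫ x, Real.exp (-(P.hamiltonian N x) / T) ∂volume := by ring

end Core

/-! ### The stub -/

/-- **Registered stub `stub_localMoment` of line `SketchIdeator2`** (`N`-UNIFORM but local: a Gibbs moment of
the contact bond). For the pinned chain (`ω₂ > 0`, `lam, β ≥ 0`) at `T > 0` there is `C = C(ω₂, lam, β, γ, T)`
(here `C = 8 C₁ + 128 β² C₃`, `C₁, C₃` the `N`-uniform second and sixth single-site Gibbs moment constants of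
`SubBallisticWindow.GibbsMoments.stub_gibbsMoments` fed with `SubBallisticWindow.GibbsPoincare.stub_gibbsPoincare`)
such that for every `N` and every contact `b`: `∂_{p_b} J ∈ L²(μ_T)` and `‖∂_{p_b} J‖²_{L²(μ_T)} ≤ C · Z`
(`∂_{p_b} J = -½ V'(r)` summed over the at most two bonds `r` touching `b`, `V'(r) = r + β r³`). [folklore] -/
theorem stub_localMoment : ∀ ω₂ lam β γ : ℝ, 0 < ω₂ → 0 ≤ lam → 0 ≤ β → ∀ T : ℝ, 0 < T →
    ∃ C : ℝ, ∀ (N : ℕ) (b : Fin N), (b.val = 0 ∨ b.val = N - 1) →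
      MemLp (partialP b (fun z : PhaseSpace N => ∑ k : Fin N, (pinnedChain ω₂ lam β γ).bondCurrent N k z)) 2
        (gibbsWeight ω₂ lam β γ N T) ∧
      ∫ x, (partialP b (fun z : PhaseSpace N => ∑ k : Fin N, (pinnedChain ω₂ lam β γ).bondCurrent N k z) x) ^ 2
          ∂(gibbsWeight ω₂ lam β γ N T) ≤
        C * ∫ x, Real.exp (-((pinnedChain ω₂ lam β γ).hamiltonian N x) / T) ∂volume := by
  intro ω₂ lam β γ hω hl hβ T hT
  have hPI := GibbsPoincare.stub_gibbsPoincare ω₂ lam β γ hω hl hβ T hT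
  obtain ⟨C₁, hC₁⟩ := GibbsMoments.stub_gibbsMoments ω₂ lam β γ hω hl hβ T hT hPI 1
  obtain ⟨C₃, hC₃⟩ := GibbsMoments.stub_gibbsMoments ω₂ lam β γ hω hl hβ T hT hPI 3
  refine ⟨8 * C₁ + 128 * β ^ 2 * C₃, fun N b _ => ?_⟩
  have hq2 : ∀ k : Fin N, ∫ x, (x.1 k) ^ 2 ∂(gibbsWeight ω₂ lam β γ N T) ≤
      C₁ * ∫ x, Real.exp (-((pinnedChain ω₂ lam β γ).hamiltonian N x) / T) ∂volume := fun k => by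
    have h := (hC₁ N k).1
    rw [show (2 * 1 : ℕ) = 2 from rfl] at h
    exact h
  have hq6 : ∀ k : Fin N, ∫ x, (x.1 k) ^ 6 ∂(gibbsWeight ω₂ lam β γ N T) ≤
      C₃ * ∫ x, Real.exp (-((pinnedChain ω₂ lam β γ).hamiltonian N x) / T) ∂volume := fun k => by
    have h := (hC₃ N k).1
    rw [show (2 * 3 : ℕ) = 6 from rfl] at h
    exact h
  exact localMoment_core hω hl hβ γ hT hq2 hq6 b

end Summit.AtomisticToContinuum.FouriersLaw.Theorems.OddSectorIrreversibility.TapLeak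

end
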